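/-
Copyright (c) 2026 the pub-hodgecm-mathlib formalisation cell (harness21).  Prover seat hodgecm-mathlib-K2Liu-p14 (g2), Track B «K2-LIT»,
#184♮ = hLiu418 = `stmt-HodgeConjecture-24832`; Road Φ ∕ socket #41, organ G5-a (Φ7-2), face (β0) of LEAD F0P6-plan RULING «M-157b», consumption side
(LEAD BATCH #5 2026-09-04T11:40:22Z; census K2Liu-p14 (g2) 11:42:27Z; booked K2E5-plan (g7) 11:43:39Z as U1-CT-ind stage-3 sub-row (β0-4)).
-/
import Summits.HodgeConjecture.HodgeConjecture.Theorems.K2LiuMiddleInnerSectionFlatCoords         -- ★ (β0-3) FILE 2 `exists_flat_coords` (+ ★ (β) capstone, ★ junction)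
import Summits.HodgeConjecture.HodgeConjecture.Theorems.K2LiuSiegelEisensteinRankZeroTermPackage   -- ★ (γ) `exists_middle_package`
import HarnessLib

/-!
# Crux `HLiu418`, Road Φ, organ G5-a, face (β0-4): THE MIDDLE CELL PACKAGE FROM ITS FACES — (α3-2)'s Borel Eisenstein sum of the inner section, read through
# the Iwasawa coordinates and untwisted (β0-1b), put in flat coordinates (★ β0-3), exhausted by Godement sections (★ β), summed by the junction (★ α-GL2)
# — IS ★ (γ)'s `hMID ∕ had ∕ hag`, hence the `(P, E⋆)`-package `E₇` of the middle cell modulo the named (δ)-inputs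

Cell `hodgecm-mathlib`, crux item hLiu418 = `stmt-HodgeConjecture-24832`; squad K2 ∕ K2Liu; prover K2Liu-p14 (g2).  THEOREMS ONLY (no `def`, no instance, no
notation, no named-fact hypothesis, no `sorry`); lane `--supports stmt-HodgeConjecture-24832 --as helper`.

THE CHAIN (every arrow a ★ theorem; every remaining input BY VALUE and NAMED for its payer):
* §1 **`middle_eq_tsum_untwisted`** — from the (α)-side identity `MID s x = Σ'_p F_s(Λ(γ̂_p · m x) · k x)` (= ★ α3-2 `middle_cell_eq_tsum` composed with the Iwasawa
  coordinates `h = n·Λ(m h)·k h` of `H(𝔸)` and the left-`N_Δ(𝔸)`-invariance of `F_s` — (β0-1a)∕(δ) letters, BY VALUE as `hMIDF`) and a character `ξ` of the ideles trivial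
  on `det GL₂(L)` (`hξL`: `χ` Hecke + product formula), the junction's (α-U) binder **`MID s x = 1 · Σ'_p φ s x (γ̂_p · m x)`** for the UNTWISTED family
  `φ s x g = ξ(det g)⁻¹ ξ(det m x) F_s(Λ g · k x)` (★ (β0-1b) `untwist_torus_law` gives it the flat law).
* §2 **`exists_middle_finite_sum`** — `φ` with the flat law + the `W`-package of ★ (β0-3) ⇒ (★ `exists_flat_coords`) `lam, b, B` ⇒ (★ (β) `exists_godement_exhaust_of_flat`)
  `κ, Φ` ⇒ (★ junction `middle_eq_sum_mirabolicEisenstein` ∕ `had_of_face` ∕ `hag_of_face`) **`MID s x = Σ_{(i,j)} a (i,j) s x · E(m x, Φ i j; s + ½)`** on `c < re s`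
  with `a` holomorphic on `{0 < re}` and `‖a ij s x‖ ≤ C · height x ^ A` locally — LITERALLY ★ (γ)'s `hMID`, `had`, `hag` (with `g j x := m x`).
* §3 **`exists_middle_package_of_faces`** — §2 fed into ★ (γ) `exists_middle_package`, whose remaining binders stay BY VALUE: the idele class domain `𝓕`, the height
  comparison `adelicHeightGL (m x) ≤ C₀ · height x ^ A₀` ((δ)-organ Siegel sets), the growth `hEg` of `E⋆` ((δ)), `hHpos`, and the continuity `hMIDc` of `MID(s, ·)`.
References: [MoeglinWaldspurger1995, II.1.7, IV.1.9]; [KudlaRallis1994, §1–§2]; [CogdellAnalyticTheory2004, §2.3]; [Tan1999, §4 Prop. 4.8].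
HONEST LABEL.  Count-neutral helper: `HC_CM` is proved only modulo the 7 printed citations (2 remaining named inputs: hLiu418 = `stmt-HodgeConjecture-24832`,
h413 = `stmt-HodgeConjecture-24833`) until rung 0 closes.
-/

set_option autoImplicit false
set_option linter.dupNamespace false -- the mandated namespace repeats `HodgeConjecture.HodgeConjecture`

noncomputable section

open MeasureTheory Measure NumberField NumberField.mixedEmbedding IsDedekindDomain Set Filter Topology Metric
open scoped NNReal Matrix BigOperators
open Literature.NumberTheory.Automorphic
open Literature.NumberTheory.GaloisRepresentations (ideleGroup)
open Summit.HodgeConjecture.HodgeConjecture.Cruxes.HLiu418.K2LiuGL2FlatSectionFiniteData (ofFinite_mem)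
open Summit.HodgeConjecture.HodgeConjecture.Cruxes.HLiu418.K2LiuGL2FlatSectionsGodementExhaust (exists_godement_exhaust_of_flat)
open Summit.HodgeConjecture.HodgeConjecture.Cruxes.HLiu418.K2LiuMiddleInnerSectionFlatCoords (exists_flat_coords)
open Summit.HodgeConjecture.HodgeConjecture.Cruxes.HLiu418.K2LiuMiddleCellGodementJunction (middle_eq_sum_mirabolicEisenstein had_of_face hag_of_face)
open Summit.HodgeConjecture.HodgeConjecture.Cruxes.HLiu418.K2LiuSiegelEisensteinRankZeroTermPackage (exists_middle_package)

namespace Summit.HodgeConjecture.HodgeConjecture.Cruxes.HLiu418.K2LiuMiddleCellPackageOfFaces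

variable {L : Type} [Field L] [NumberField L]

/-! ## §1 From the inner section to the untwisted family: the junction's (α-U) binder -/

section Untwist

variable {X H : Type*} [Group H]

/-- **THE (α-U) BINDER FOR THE UNTWISTED FAMILY.**  If `MID s x = Σ'_p F_s(Λ(γ̂_p · m x) · k x)` and `ξ(det γ̂) = 1` on `GL₂(L)`, then for
`φ s x g := ξ(det g)⁻¹ · ξ(det m x) · F_s(Λ g · k x)`: `MID s x = 1 · Σ'_p φ s x (γ̂_p · m x)`. [cite: MoeglinWaldspurger1995, II.1.7] -/
theorem middle_eq_tsum_untwisted (Λ : GL (Fin 2) (AdeleRing (𝓞 L) L) →* H) (ξ : (AdeleRing (𝓞 L) L)ˣ →* ℂˣ)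
    (hξL : ∀ γ₀ : GL (Fin 2) L, ξ (Matrix.GeneralLinearGroup.det (Matrix.GeneralLinearGroup.map (algebraMap L (AdeleRing (𝓞 L) L)) γ₀)) = 1)
    (F : ℂ → H → ℂ) (kx : X → H) (mx : X → GL (Fin 2) (AdeleRing (𝓞 L) L)) (γ : Projectivization L (Fin 2 → L) → GL (Fin 2) L)
    (MID : ℂ → X → ℂ) {c : ℝ}
    (hMIDF : ∀ (s : ℂ) (x : X), c < s.re → MID s x = ∑' p : Projectivization L (Fin 2 → L),
      F s (Λ (Matrix.GeneralLinearGroup.map (algebraMap L (AdeleRing (𝓞 L) L)) (γ p) * mx x) * kx x))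
    (φ : ℂ → X → GL (Fin 2) (AdeleRing (𝓞 L) L) → ℂ)
    (hφ : ∀ s x g, φ s x g = (((ξ (Matrix.GeneralLinearGroup.det g))⁻¹ : ℂˣ) : ℂ) * ((ξ (Matrix.GeneralLinearGroup.det (mx x)) : ℂˣ) : ℂ) * F s (Λ g * kx x))
    (s : ℂ) (x : X) (hs : c < s.re) :
    MID s x = 1 * ∑' p : Projectivization L (Fin 2 → L), φ s x (Matrix.GeneralLinearGroup.map (algebraMap L (AdeleRing (𝓞 L) L)) (γ p) * mx x) := by
  rw [hMIDF s x hs, one_mul]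
  refine tsum_congr fun p => ?_
  rw [hφ, map_mul Matrix.GeneralLinearGroup.det, map_mul ξ, hξL, one_mul, Units.inv_mul, one_mul]

end Untwist

/-! ## §2 The middle cell is a finite sum of mirabolic Eisenstein series — ★ (γ)'s `hMID ∕ had ∕ hag` -/

section Assembly

variable [IsTotallyComplex L] [MeasurableSpace (AdeleRing (𝓞 L) L)] [BorelSpace (AdeleRing (𝓞 L) L)]
  (ν : Measure (ideleGroup L)) [ν.IsHaarMeasure] (μinf : Measure (mixedSpace L)ˣ) [μinf.IsHaarMeasure]
  (S : Finset (HeightOneSpectrum (𝓞 L))) (γl : ∀ v : HeightOneSpectrum (𝓞 L), ValuativeRel.ValueGroupWithZero (v.adicCompletion L))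
  (hγ0 : ∀ v ∈ S, γl v ≠ 0) (hγ1 : ∀ v ∈ S, γl v < 1)
  {X : Type*} (height : X → ℝ) (hpos : ∀ x, 0 < height x)
  (W : Submodule ℂ (↥(standardMaximalCompactGL 2 L) → ℂ)) [FiniteDimensional ℂ W]
  (hWstab : ∀ B ∈ W, ∀ k₀ : ↥(standardMaximalCompactGL 2 L), (fun k => B (k * k₀)) ∈ W)
  (hWlaw : ∀ B ∈ W, ∀ p k : ↥(standardMaximalCompactGL 2 L),
    ((p : GL (Fin 2) (AdeleRing (𝓞 L) L)) : Matrix (Fin 2) (Fin 2) (AdeleRing (𝓞 L) L)) 1 0 = 0 → B (p * k) = B k)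
  (hWlev : ∀ B ∈ W, ∀ (k : ↥(standardMaximalCompactGL 2 L)) (r : GL (Fin 2) (FiniteAdeleRing (𝓞 L) L)) (hr : r ∈ glFiniteIntegralLevel 2 L),
    (∀ v ∈ S, GLn.evalAt 2 L v r ∈ congruenceGL 2 (γl v)) →
      B ⟨(k : GL (Fin 2) (AdeleRing (𝓞 L) L)) * GLn.ofFinite 2 L r, (standardMaximalCompactGL 2 L).mul_mem k.2 (ofFinite_mem hr)⟩ = B k)
  (hWcont : ∀ B ∈ W, Continuous B)
  (hWext : ∀ B ∈ W, ∃ bB : ℂ → GL (Fin 2) (AdeleRing (𝓞 L) L) → ℂ,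
    (∀ s : ℂ, 0 < s.re → ∀ (d : Fin 2 → (AdeleRing (𝓞 L) L)ˣ) (g : GL (Fin 2) (AdeleRing (𝓞 L) L)),
      bB s (glDiagonal 2 (AdeleRing (𝓞 L) L) d * g) =
        ((IdeleClassGroup.ideleNorm L (d 0) : ℝ) : ℂ) ^ (s + 1 / 2) * ((IdeleClassGroup.ideleNorm L (d 1) : ℝ) : ℂ) ^ (-(s + 1 / 2)) * bB s g) ∧
    (∀ s : ℂ, 0 < s.re → ∀ u g : GL (Fin 2) (AdeleRing (𝓞 L) L), (u : Matrix (Fin 2) (Fin 2) (AdeleRing (𝓞 L) L)) 1 0 = 0 →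
      (u : Matrix (Fin 2) (Fin 2) (AdeleRing (𝓞 L) L)) 0 0 = 1 → (u : Matrix (Fin 2) (Fin 2) (AdeleRing (𝓞 L) L)) 1 1 = 1 → bB s (u * g) = bB s g) ∧
    (∀ s : ℂ, 0 < s.re → ∀ (k : GL (Fin 2) (AdeleRing (𝓞 L) L)) (hk : k ∈ standardMaximalCompactGL 2 L), bB s k = B ⟨k, hk⟩))
  (φ : ℂ → X → GL (Fin 2) (AdeleRing (𝓞 L) L) → ℂ)
  (hφT : ∀ (s : ℂ) (x : X), 0 < s.re → ∀ (d : Fin 2 → (AdeleRing (𝓞 L) L)ˣ) (g : GL (Fin 2) (AdeleRing (𝓞 L) L)),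
    φ s x (glDiagonal 2 (AdeleRing (𝓞 L) L) d * g) =
      ((IdeleClassGroup.ideleNorm L (d 0) : ℝ) : ℂ) ^ (s + 1 / 2) * ((IdeleClassGroup.ideleNorm L (d 1) : ℝ) : ℂ) ^ (-(s + 1 / 2)) * φ s x g)
  (hφN : ∀ (s : ℂ) (x : X), 0 < s.re → ∀ u g : GL (Fin 2) (AdeleRing (𝓞 L) L), (u : Matrix (Fin 2) (Fin 2) (AdeleRing (𝓞 L) L)) 1 0 = 0 →
    (u : Matrix (Fin 2) (Fin 2) (AdeleRing (𝓞 L) L)) 0 0 = 1 → (u : Matrix (Fin 2) (Fin 2) (AdeleRing (𝓞 L) L)) 1 1 = 1 → φ s x (u * g) = φ s x g)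
  (hφW : ∀ (s : ℂ) (x : X), 0 < s.re → (fun k : ↥(standardMaximalCompactGL 2 L) => φ s x k) ∈ W)
  (hφhol : ∀ (x : X) (k : ↥(standardMaximalCompactGL 2 L)), DifferentiableOn ℂ (fun s => φ s x k) {s : ℂ | 0 < s.re})
  (hφbd : ∀ z : ℂ, 0 < z.re → ∃ C A r : ℝ, 0 ≤ C ∧ 0 ≤ A ∧ 0 < r ∧ ∀ s : ℂ, dist s z < r →
    ∀ (x : X) (k : ↥(standardMaximalCompactGL 2 L)), ‖φ s x k‖ ≤ C * height x ^ A)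
  (mx : X → GL (Fin 2) (AdeleRing (𝓞 L) L)) (γ : Projectivization L (Fin 2 → L) → GL (Fin 2) L)
  (hγ : ∀ p, ∃ cL : L, cL ≠ 0 ∧ (Pi.single 1 1 : Fin 2 → L) ᵥ* (γ p : Matrix (Fin 2) (Fin 2) L) = cL • p.rep)
  {c : ℝ} (hc : 1 / 2 ≤ c) (c₀ : ℂ) (MID : ℂ → X → ℂ)
  (hMID : ∀ (s : ℂ) (x : X), c < s.re → MID s x = c₀ * ∑' p : Projectivization L (Fin 2 → L),
    φ s x (Matrix.GeneralLinearGroup.map (algebraMap L (AdeleRing (𝓞 L) L)) (γ p) * mx x))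

include μinf hγ0 hγ1 hpos hWstab hWlaw hWlev hWcont hWext hφT hφN hφW hφhol hφbd hγ hc hMID in
/-- **(β0-4) THE MIDDLE CELL IS A FINITE SUM OF MIRABOLIC EISENSTEIN SERIES OF GODEMENT SECTIONS, WITH HOLOMORPHIC COEFFICIENTS OF MODERATE GROWTH** — ★ (γ)
`exists_middle_package`'s `hΦ ∕ had ∕ hag ∕ hMID` binders (with `g j x := m x`), from the faces: (α-U) `hMID`, (β0-3) the `W`-package + the flat family `φ` (★
`exists_flat_coords`), (β) ★ `exists_godement_exhaust_of_flat`, summed by ★ `middle_eq_sum_mirabolicEisenstein`. [cite: MoeglinWaldspurger1995, II.1.7, IV.1.9]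
[cite: CogdellAnalyticTheory2004, §2.3] -/
theorem exists_middle_finite_sum :
    ∃ (ι : Type) (_ : Fintype ι) (a : ι → ℂ → X → ℂ) (Φ : ι → (Fin 2 → AdeleRing (𝓞 L) L) → ℂ),
      (∀ j, Φ j ∈ piSchwartzBruhat L (Fin 2)) ∧
      (∀ j x, DifferentiableOn ℂ (fun s => a j s x) {s : ℂ | 0 < s.re}) ∧
      (∀ z : ℂ, 0 < z.re → ∃ C A r : ℝ, 0 ≤ C ∧ 0 ≤ A ∧ 0 < r ∧ ∀ s : ℂ, dist s z < r → ∀ j x, ‖a j s x‖ ≤ C * height x ^ A) ∧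
      (∀ (s : ℂ) (x : X), c < s.re → MID s x = ∑ j, a j s x * mirabolicEisenstein L ν (Φ j) (s + 1 / 2) (mx x)) := by
  -- (β0-3): flat coordinates
  obtain ⟨I, instI, lam, b, B, hφ, hlam, hlamb, hT, hN, hbK, hBK, hlev, hcont, hfin⟩ :=
    exists_flat_coords S γl height W hWstab hWlaw hWlev hWcont hWext φ hφT hφN hφW hφhol hφbd
  -- (β): Godement exhaust of the flat basis
  obtain ⟨J, instJ, κ, Φ, hΦ, hκd, hκb, hb⟩ := exists_godement_exhaust_of_flat ν μinf S γl hγ0 hγ1 b B hT hN hbK hBK hlev hcont hfin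
  -- the junction
  refine ⟨I × J, inferInstance, fun ij s x => c₀ * lam ij.1 s x * κ ij.1 ij.2 s, fun ij => Φ ij.1 ij.2, fun ij => hΦ ij.1 ij.2,
    fun ij x => had_of_face c₀ hlam hκd ij x, fun z hz => hag_of_face height hpos c₀ hlamb hκb z hz, fun s x hs => ?_⟩
  have hs0 : 0 < s.re := by linarith
  exact middle_eq_sum_mirabolicEisenstein ν Φ hΦ mx (Pi.single 1 1) γ hγ hc c₀ MID φ hMID lam b
    (fun s x g hs' => hφ s x g (by linarith)) κ (fun i s g hs' => hb i s g (by linarith)) s x hs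

end Assembly

/-! ## §3 The `(P, E⋆)`-package of the middle cell modulo the named (δ)-inputs -/

section Package

variable [IsTotallyComplex L] [MeasurableSpace (AdeleRing (𝓞 L) L)] [BorelSpace (AdeleRing (𝓞 L) L)]
  (ν : Measure (ideleGroup L)) [ν.IsHaarMeasure] (μ : Measure (Fin 2 → AdeleRing (𝓞 L) L)) [μ.IsAddHaarMeasure]
  (μinf : Measure (mixedSpace L)ˣ) [μinf.IsHaarMeasure]
  (S : Finset (HeightOneSpectrum (𝓞 L))) (γl : ∀ v : HeightOneSpectrum (𝓞 L), ValuativeRel.ValueGroupWithZero (v.adicCompletion L))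
  (hγ0 : ∀ v ∈ S, γl v ≠ 0) (hγ1 : ∀ v ∈ S, γl v < 1)
  {X : Type*} [TopologicalSpace X] [FirstCountableTopology X]
  (height : X → ℝ) (hpos : ∀ x, 0 < height x) (hcpt : ∀ K : Set X, IsCompact K → ∃ Bd : ℝ, ∀ x ∈ K, height x ≤ Bd)
  (W : Submodule ℂ (↥(standardMaximalCompactGL 2 L) → ℂ)) [FiniteDimensional ℂ W]
  (hWstab : ∀ B ∈ W, ∀ k₀ : ↥(standardMaximalCompactGL 2 L), (fun k => B (k * k₀)) ∈ W)
  (hWlaw : ∀ B ∈ W, ∀ p k : ↥(standardMaximalCompactGL 2 L),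
    ((p : GL (Fin 2) (AdeleRing (𝓞 L) L)) : Matrix (Fin 2) (Fin 2) (AdeleRing (𝓞 L) L)) 1 0 = 0 → B (p * k) = B k)
  (hWlev : ∀ B ∈ W, ∀ (k : ↥(standardMaximalCompactGL 2 L)) (r : GL (Fin 2) (FiniteAdeleRing (𝓞 L) L)) (hr : r ∈ glFiniteIntegralLevel 2 L),
    (∀ v ∈ S, GLn.evalAt 2 L v r ∈ congruenceGL 2 (γl v)) →
      B ⟨(k : GL (Fin 2) (AdeleRing (𝓞 L) L)) * GLn.ofFinite 2 L r, (standardMaximalCompactGL 2 L).mul_mem k.2 (ofFinite_mem hr)⟩ = B k)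
  (hWcont : ∀ B ∈ W, Continuous B)
  (hWext : ∀ B ∈ W, ∃ bB : ℂ → GL (Fin 2) (AdeleRing (𝓞 L) L) → ℂ,
    (∀ s : ℂ, 0 < s.re → ∀ (d : Fin 2 → (AdeleRing (𝓞 L) L)ˣ) (g : GL (Fin 2) (AdeleRing (𝓞 L) L)),
      bB s (glDiagonal 2 (AdeleRing (𝓞 L) L) d * g) =
        ((IdeleClassGroup.ideleNorm L (d 0) : ℝ) : ℂ) ^ (s + 1 / 2) * ((IdeleClassGroup.ideleNorm L (d 1) : ℝ) : ℂ) ^ (-(s + 1 / 2)) * bB s g) ∧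
    (∀ s : ℂ, 0 < s.re → ∀ u g : GL (Fin 2) (AdeleRing (𝓞 L) L), (u : Matrix (Fin 2) (Fin 2) (AdeleRing (𝓞 L) L)) 1 0 = 0 →
      (u : Matrix (Fin 2) (Fin 2) (AdeleRing (𝓞 L) L)) 0 0 = 1 → (u : Matrix (Fin 2) (Fin 2) (AdeleRing (𝓞 L) L)) 1 1 = 1 → bB s (u * g) = bB s g) ∧
    (∀ s : ℂ, 0 < s.re → ∀ (k : GL (Fin 2) (AdeleRing (𝓞 L) L)) (hk : k ∈ standardMaximalCompactGL 2 L), bB s k = B ⟨k, hk⟩))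
  (φ : ℂ → X → GL (Fin 2) (AdeleRing (𝓞 L) L) → ℂ)
  (hφT : ∀ (s : ℂ) (x : X), 0 < s.re → ∀ (d : Fin 2 → (AdeleRing (𝓞 L) L)ˣ) (g : GL (Fin 2) (AdeleRing (𝓞 L) L)),
    φ s x (glDiagonal 2 (AdeleRing (𝓞 L) L) d * g) =
      ((IdeleClassGroup.ideleNorm L (d 0) : ℝ) : ℂ) ^ (s + 1 / 2) * ((IdeleClassGroup.ideleNorm L (d 1) : ℝ) : ℂ) ^ (-(s + 1 / 2)) * φ s x g)
  (hφN : ∀ (s : ℂ) (x : X), 0 < s.re → ∀ u g : GL (Fin 2) (AdeleRing (𝓞 L) L), (u : Matrix (Fin 2) (Fin 2) (AdeleRing (𝓞 L) L)) 1 0 = 0 →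
    (u : Matrix (Fin 2) (Fin 2) (AdeleRing (𝓞 L) L)) 0 0 = 1 → (u : Matrix (Fin 2) (Fin 2) (AdeleRing (𝓞 L) L)) 1 1 = 1 → φ s x (u * g) = φ s x g)
  (hφW : ∀ (s : ℂ) (x : X), 0 < s.re → (fun k : ↥(standardMaximalCompactGL 2 L) => φ s x k) ∈ W)
  (hφhol : ∀ (x : X) (k : ↥(standardMaximalCompactGL 2 L)), DifferentiableOn ℂ (fun s => φ s x k) {s : ℂ | 0 < s.re})
  (hφbd : ∀ z : ℂ, 0 < z.re → ∃ C A r : ℝ, 0 ≤ C ∧ 0 ≤ A ∧ 0 < r ∧ ∀ s : ℂ, dist s z < r →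
    ∀ (x : X) (k : ↥(standardMaximalCompactGL 2 L)), ‖φ s x k‖ ≤ C * height x ^ A)
  (mx : X → GL (Fin 2) (AdeleRing (𝓞 L) L)) {C₀ A₀ : ℝ} (hC₀ : 0 ≤ C₀) (hA₀ : 0 ≤ A₀)
  (hmx : ∀ x, adelicHeightGL 2 L (mx x) ≤ C₀ * height x ^ A₀)
  (γ : Projectivization L (Fin 2 → L) → GL (Fin 2) L)
  (hγ : ∀ p, ∃ cL : L, cL ≠ 0 ∧ (Pi.single 1 1 : Fin 2 → L) ᵥ* (γ p : Matrix (Fin 2) (Fin 2) L) = cL • p.rep)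
  {𝓕 : Set (ideleGroup L)} (h𝓕 : IsIdeleClassDomain L 𝓕)
  (hEg : ∀ z' : ℂ, 1 / 2 < z'.re → ∃ C A r : ℝ, 0 ≤ C ∧ 0 ≤ A ∧ 0 < r ∧ ∀ s' : ℂ, dist s' z' < r →
    ∀ (Ψ : (Fin 2 → AdeleRing (𝓞 L) L) → ℂ), Ψ ∈ piSchwartzBruhat L (Fin 2) →
      ∀ gg : GL (Fin 2) (AdeleRing (𝓞 L) L), ‖tateNumeratorGL ν μ 𝓕 Ψ s' gg‖ ≤ C * adelicHeightGL 2 L gg ^ A)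
  (hHpos : ∀ gg : GL (Fin 2) (AdeleRing (𝓞 L) L), 0 < adelicHeightGL 2 L gg)
  {c : ℝ} (hc : 1 / 2 ≤ c) (c₀ : ℂ) (MID : ℂ → X → ℂ) (hMIDc : ∀ s : ℂ, c < s.re → Continuous (MID s))
  (hMID : ∀ (s : ℂ) (x : X), c < s.re → MID s x = c₀ * ∑' p : Projectivization L (Fin 2 → L),
    φ s x (Matrix.GeneralLinearGroup.map (algebraMap L (AdeleRing (𝓞 L) L)) (γ p) * mx x))

include hγ0 hγ1 hpos hcpt hWstab hWlaw hWlev hWcont hWext hφT hφN hφW hφhol hφbd hC₀ hA₀ hmx hγ h𝓕 hEg hHpos hc hMIDc hMID μinf in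
/-- **(β0-4) THE `(P, E⋆)`-PACKAGE OF THE MIDDLE CELL FROM ITS FACES** (★ (γ) `exists_middle_package` instantiated through §2; its remaining binders — the idele class
domain, the height comparison of the Iwasawa coordinate `m x`, the growth of `E⋆` UNIFORM over Schwartz data `hEg`, `hHpos`, the continuity of `MID(s, ·)` — BY VALUE).
[cite: MoeglinWaldspurger1995, II.1.7, IV.1.9] [cite: CogdellAnalyticTheory2004, §2.3 Thm. 2.2] [cite: Tan1999, §4 Prop. 4.8] -/
theorem exists_middle_package_of_faces :
    ∃ E₇ : ℂ → X → ℂ,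
      (∀ x, DifferentiableOn ℂ (fun s => E₇ s x) {s : ℂ | 0 < s.re}) ∧
      (∀ s : ℂ, 0 < s.re → Continuous (E₇ s)) ∧
      (∀ (s : ℂ) (x : X), c < s.re → E₇ s x = (∏ p ∈ ({1 / 2} : Finset ℂ), (s - p)) * MID s x) ∧
      (∀ z : ℂ, 0 < z.re → ∃ C A r : ℝ, 0 < r ∧ ∀ s : ℂ, dist s z < r → ∀ x, ‖E₇ s x‖ ≤ C * height x ^ A) := by
  obtain ⟨ι, instι, a, Φ, hΦ, had, hag, hsum⟩ := exists_middle_finite_sum ν μinf S γl hγ0 hγ1 height hpos W hWstab hWlaw hWlev hWcont hWext φ hφT hφN hφW hφhol hφbd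
    mx γ hγ hc c₀ MID hMID
  exact exists_middle_package ν μ (by norm_num : 0 < 2) h𝓕 height hpos hcpt Φ hΦ (fun _ => mx) hC₀ hA₀ (fun _ x => hmx x) a had hag
    (fun z' hz' => by
      obtain ⟨C, A, r, hC, hA, hr, h⟩ := hEg z' hz'
      exact ⟨C, A, r, hC, hA, hr, fun s' hs' j gg => h s' hs' (Φ j) (hΦ j) gg⟩)
    hHpos hc MID hMIDc hsum

end Package

end Summit.HodgeConjecture.HodgeConjecture.Cruxes.HLiu418.K2LiuMiddleCellPackageOfFaces

end
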